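/-
Copyright (c) 2026 the pub-hodgecm-mathlib formalisation cell (harness21).  Prover seat hodgecm-mathlib-R90-C10-p06 (g3), R90-TF SLAB section S1 «Ch10-local» (base
R90-C10), h413 = `stmt-HodgeConjecture-24833`; line «B_pos», RAMIFIED TAME corner (B-10), card (6c) (dealer R90-C10-plan (g2) handoff table 2026-09-05T01:41:51Z; paper step
`R90/R90-C10-p08/g2/PAPER-Pram1-GaussSumEntries.md` §2–§3): «THE RAMIFIED MASTER INTEGRAL — the cut-off shell sum when the EVEN shells vanish and the ODD shells are geometric»,
hypothesis-first on the per-shell values (letters of (6a)(6b)).  2026-09-05.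
-/
import Summits.HodgeConjecture.HodgeConjecture.Theorems.R90S1BposCutoffShellSum   -- ★ p864150 (this seat) part 3a: `iUnion_shell_cut_eq_cutoff`, `shell_cut_disjoint` (place-free set theory of the cut shells); brings ★ `K2E3BranchBShellSeries`, the frame v1
import HarnessLib

/-!
# R90-TF S1 «Ch10-local» ∕ K2 E3 «U4Keys» :182, BRANCH B AT POSITIVE DEPTH, RAMIFIED TAME corner — card (6c): THE RAMIFIED MASTER INTEGRAL (shell sum)
# «even shells `0`, odd shells `Sh_{2κ+1} = C·X^{κ+1}` ⟹ `∫_{e^{j₀} ≤ |z|, |x| ≤ |ϖ|^ν|z|} F dμ = C·X·(1 − X)⁻¹` for `j₀ ∈ {0, 1}` — so `G₁ = G(1) = G(0) = G₂`»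
# [Keys1984 §7 Thm (2) (d); Casselman1980 §3; Casselman1995 §6.4; Rogawski1990 §1.10, §12.2 (2); WeilBNT1967 Ch. II §5]

Cell `pub/hodgecm-mathlib`, crux H413 = `stmt-HodgeConjecture-24833`, route of record `HCCMUnconditional` (no route verbs); R90-TF section S1 (junction socket A2′ = U4Keys :217,
REL over (S-I) ∕ (S-RT) ∕ (S-W) of organ ED. 10).  THEOREMS ONLY (no `def`, no `instance`, no `notation`, no named-fact hypothesis, no `sorry`); lane `--supports stmt-HodgeConjecture-24833
--as helper`, count-neutral.  NOT THE PAYER of :182.  FRAME = the «U4-RAM» frame v1 of ★ part 2 ∕ ★ part 3a: `N := (cmBorelTriple L 3 v).N`, entries `z := n₀₂`, `x := n₀₁`, a place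
`w ∣ v`, a uniformiser `ϖ` of `L_w` (`hϖ`; at a ramified place any uniformiser of `L_w`), ANY measure `μ` on `N`, ANY `F : N → ℂ` — place-free, character-free: the ramified content
(★ `R90S1BposRamSkewLineCayley`, (6a) signed spheres ∕ Gauss sum, (6b) shell fibres and cut-off shells) enters only through the LETTERS `heven`, `hodd`.

THE POINT (P-ram-1 §2–§3; ★ (7) `R90S1BposRamDeterminantClosedForm` letters `h11v`, `hwwv`).  At a tame ramified place the big-cell entries of the Casselman pair at Roche's `J_e`,
`e = (ν, 0; ν, 1)`, are `G₂ = G(0)` and `G₁ = G(1)` with `G(j₀) := ∫_{C(ν, j₀)} F₀`, `C(ν, j₀) = {e^{j₀} ≤ |z|_w, |x|_w ≤ |ϖ|^ν|z|_w}`; shell by shell (`|z|_w = eʲ`), EVERY EVEN shell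
vanishes (P-ram-1 (E)) and the ODD shell `j = 2κ + 1` carries `C·X^{κ+1}` (P-ram-1 (O), `X = χ₁(Π·σΠ)`, `C` the Gauss-sum constant of (6a)(6b); `C = 0` in the sub-branch (R-a)).  Hence
`G(0) = G(1) = Σ_{κ ≥ 0} C·X^{κ+1} = C·X·(1 − X)⁻¹` (`‖X‖ < 1`): the shells `j = j₀ + i` of `C(ν, j₀)` (★ part 3a `iUnion_shell_cut_eq_cutoff` ∕ `shell_cut_disjoint`, Borel by the letter
`hmeas` — ★ part 2 `measurableSet_shell_cut` at an unramified place, (6b)(A) `R90S1BposRamShellMeasurability` at a ramified one) are summed by Mathlib `hasSum_integral_iUnion`, and the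
parity-supported shell law is the push-forward of the geometric series along `κ ↦ 2κ + 1 − j₀` (Mathlib `Function.Injective.hasSum_iff`, `hasSum_geometric_of_norm_lt_one`).  With
`C := V₁·Γ` this is ★ (7)'s `Λ11 = V₁·(Γ·X ∕ (1 − X))` ∕ `Λww = V₂·(Γ·X ∕ (1 − X))` (`ring`); the constant relation `Γ²·X = (q−1)²·q^{−(2ν+1)}` is (6a)(6b)'s evaluation of `C²` (P-ram-1 §2
«`C² = q^{1−n}(1 − q⁻¹)²∕X`»), recorded here as the pure-algebra §3 `gamma_sq_mul_eq_of_const_sq`.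
* §1 **`setIntegral_cutoff_eq_of_hasSum_shell_values`** — ★ part 3a's shell sum with an ARBITRARY summable shell law (`HasSum a s` ⊢ `∫_C F = s`);
* §2 **`setIntegral_cutoff_eq_of_even_odd_shells`** — even shells `0`, odd shells `C·X^{κ+1}`, `j₀ ≤ 1` ⊢ `∫_{C(ν,j₀)} F = C·X·(1 − X)⁻¹`;
* §3 `gamma_sq_mul_eq_of_const_sq` — `C = V·Γ`, `V ≠ 0`, `C²·X = V²·((q−1)²·(q^{2ν+1})⁻¹)` ⊢ ★ (7)'s `hΓ : Γ²·X = (q−1)²·(q^{2ν+1})⁻¹`.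
HONEST LABEL.  HC_CM is proved only modulo the 7 printed citations (2 remaining named inputs: hLiu418 = `stmt-HodgeConjecture-24832`, h413 = `stmt-HodgeConjecture-24833`) until rung 0
closes; count-neutral — this file does NOT pay :182 or A2′; no printed citation is discharged; the per-shell values are LETTERS paid by (6a)(6b).

## References
* [Keys1984] D. Keys, *Principal series representations of special unitary groups over local fields*, Compositio Math. 51 (1984), §7 Theorem (2) (d) p. 126.
* [Casselman1980] W. Casselman, *The unramified principal series of p-adic groups I*, Compositio Math. 40 (1980), §3 (intertwining integrals over `N`).
* [Casselman1995] W. Casselman, *Introduction to the theory of admissible representations of `p`-adic reductive groups* (1995), §6.4 p. 63 (shell-by-shell evaluation).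
* [Rogawski1990] J. D. Rogawski, *Automorphic Representations of Unitary Groups in Three Variables*, Ann. of Math. Stud. 123 (1990), §1.10 p. 9, §12.2 (2) p. 173.
* [WeilBNT1967] A. Weil, *Basic Number Theory* (1967), Ch. II §5 (σ-additivity of integrals over level sets).
-/

set_option autoImplicit false
-- the mandated namespace has the single-problem summit's repeated segment (`HodgeConjecture.HodgeConjecture`)
set_option linter.dupNamespace false

noncomputable section

open NumberField IsDedekindDomain MeasureTheory Measure
open scoped Matrix MatrixGroups WithZero Valued NNReal ENNReal
open Literature.NumberTheory Literature.NumberTheory.Automorphic Literature.NumberTheory.Automorphic.UnitaryGroup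

namespace Summit.HodgeConjecture.HodgeConjecture.R90.S1.BposRamMasterIntegral

open Summit.HodgeConjecture.HodgeConjecture.Cruxes.H413
open Summit.HodgeConjecture.HodgeConjecture.R90.S1.BposCutoffShellSum

-- the frame-v1 shell statements on the matrix-group carrier of `N(L⁺_v)` (class of ★ part 2 ∕ part 3b: the default budget times out while elaborating the binders)
set_option synthInstance.maxHeartbeats 400000
set_option maxHeartbeats 1600000

variable (L : Type) [Field L] [NumberField L] [IsCMField L] (v : HeightOneSpectrum (𝓞 ↥(maximalRealSubfield L)))
  (w : PlacesOver L v)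

/-! ## §1 The shell sum with an arbitrary summable shell law -/

/-- **THE SHELL SUM OVER THE CUT-OFF REGION, ARBITRARY SUMMABLE SHELL LAW.**  For ANY measure `μ` on `N(L⁺_v)`, ANY `F : N → ℂ` integrable on
`C(ρ, j₀) = {e^{j₀} ≤ |z|_w ∧ |x|_w ≤ |ϖ|_w^ρ·|z|_w}`, Borel cut shells (`hmeas`), and a shell law `a : ℕ → ℂ` with `HasSum a s`: if the cut shell `{|z|_w = e^{j₀+i} ∧ |x|_w ≤ e^{j₀+i−ρ}}`
carries the value `a i` for every `i`, then `∫_{C(ρ, j₀)} F dμ = s` (★ part 3a `iUnion_shell_cut_eq_cutoff` ∕ `shell_cut_disjoint`, Mathlib `hasSum_integral_iUnion`, `HasSum.unique`).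
[cite: WeilBNT1967, Ch. II §5] [cite: Casselman1995, §6.4 p. 63] -/
theorem setIntegral_cutoff_eq_of_hasSum_shell_values [MeasurableSpace ↥(cmBorelTriple L 3 v).N] (μ : Measure ↥(cmBorelTriple L 3 v).N)
    {ϖ : w.1.adicCompletion L} (hϖ : Valued.v ϖ = WithZero.exp (-1 : ℤ))
    (hmeas : ∀ j t : ℤ, MeasurableSet {m : ↥(cmBorelTriple L 3 v).N |
      Valued.v (((((m : ↥(unitaryGroupOfForm (conjLocal L (IsCMField.complexConj L) v) (cmLocalForm L 3 v))) : GL (Fin 3) (LocalRing L v)) : Matrix (Fin 3) (Fin 3) (LocalRing L v)) 0 2) w) = WithZero.exp j ∧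
      Valued.v (((((m : ↥(unitaryGroupOfForm (conjLocal L (IsCMField.complexConj L) v) (cmLocalForm L 3 v))) : GL (Fin 3) (LocalRing L v)) : Matrix (Fin 3) (Fin 3) (LocalRing L v)) 0 1) w) ≤ WithZero.exp t})
    (F : ↥(cmBorelTriple L 3 v).N → ℂ) (ρ j₀ : ℕ)
    (hF : IntegrableOn F {n : ↥(cmBorelTriple L 3 v).N |
      WithZero.exp (j₀ : ℤ) ≤ Valued.v (((((n : ↥(unitaryGroupOfForm (conjLocal L (IsCMField.complexConj L) v) (cmLocalForm L 3 v))) : GL (Fin 3) (LocalRing L v)) : Matrix (Fin 3) (Fin 3) (LocalRing L v)) 0 2) w) ∧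
      Valued.v (((((n : ↥(unitaryGroupOfForm (conjLocal L (IsCMField.complexConj L) v) (cmLocalForm L 3 v))) : GL (Fin 3) (LocalRing L v)) : Matrix (Fin 3) (Fin 3) (LocalRing L v)) 0 1) w) ≤
        Valued.v ϖ ^ ρ * Valued.v (((((n : ↥(unitaryGroupOfForm (conjLocal L (IsCMField.complexConj L) v) (cmLocalForm L 3 v))) : GL (Fin 3) (LocalRing L v)) : Matrix (Fin 3) (Fin 3) (LocalRing L v)) 0 2) w)} μ)
    (a : ℕ → ℂ) (s : ℂ) (ha : HasSum a s)
    (hshell : ∀ i : ℕ, ∫ n in {m : ↥(cmBorelTriple L 3 v).N |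
        Valued.v (((((m : ↥(unitaryGroupOfForm (conjLocal L (IsCMField.complexConj L) v) (cmLocalForm L 3 v))) : GL (Fin 3) (LocalRing L v)) : Matrix (Fin 3) (Fin 3) (LocalRing L v)) 0 2) w) =
            WithZero.exp ((j₀ + i : ℕ) : ℤ) ∧
        Valued.v (((((m : ↥(unitaryGroupOfForm (conjLocal L (IsCMField.complexConj L) v) (cmLocalForm L 3 v))) : GL (Fin 3) (LocalRing L v)) : Matrix (Fin 3) (Fin 3) (LocalRing L v)) 0 1) w) ≤
            WithZero.exp (((j₀ + i : ℕ) : ℤ) - ρ)}, F n ∂μ = a i) :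
    ∫ n in {n : ↥(cmBorelTriple L 3 v).N |
      WithZero.exp (j₀ : ℤ) ≤ Valued.v (((((n : ↥(unitaryGroupOfForm (conjLocal L (IsCMField.complexConj L) v) (cmLocalForm L 3 v))) : GL (Fin 3) (LocalRing L v)) : Matrix (Fin 3) (Fin 3) (LocalRing L v)) 0 2) w) ∧
      Valued.v (((((n : ↥(unitaryGroupOfForm (conjLocal L (IsCMField.complexConj L) v) (cmLocalForm L 3 v))) : GL (Fin 3) (LocalRing L v)) : Matrix (Fin 3) (Fin 3) (LocalRing L v)) 0 1) w) ≤
        Valued.v ϖ ^ ρ * Valued.v (((((n : ↥(unitaryGroupOfForm (conjLocal L (IsCMField.complexConj L) v) (cmLocalForm L 3 v))) : GL (Fin 3) (LocalRing L v)) : Matrix (Fin 3) (Fin 3) (LocalRing L v)) 0 2) w)}, F n ∂μ = s := by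
  rw [← iUnion_shell_cut_eq_cutoff L v w hϖ ρ j₀] at hF ⊢
  have hsum := hasSum_integral_iUnion (μ := μ) (f := F) (fun i => hmeas ((j₀ + i : ℕ) : ℤ) (((j₀ + i : ℕ) : ℤ) - ρ)) (shell_cut_disjoint L v w ρ j₀) hF
  have hfun : (fun i : ℕ => ∫ n in {m : ↥(cmBorelTriple L 3 v).N |
        Valued.v (((((m : ↥(unitaryGroupOfForm (conjLocal L (IsCMField.complexConj L) v) (cmLocalForm L 3 v))) : GL (Fin 3) (LocalRing L v)) : Matrix (Fin 3) (Fin 3) (LocalRing L v)) 0 2) w) =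
            WithZero.exp ((j₀ + i : ℕ) : ℤ) ∧
        Valued.v (((((m : ↥(unitaryGroupOfForm (conjLocal L (IsCMField.complexConj L) v) (cmLocalForm L 3 v))) : GL (Fin 3) (LocalRing L v)) : Matrix (Fin 3) (Fin 3) (LocalRing L v)) 0 1) w) ≤
            WithZero.exp (((j₀ + i : ℕ) : ℤ) - ρ)}, F n ∂μ) = a := funext hshell
  rw [hfun] at hsum
  exact hsum.unique ha

/-! ## §2 Even shells vanish, odd shells geometric -/

/-- **The parity-supported geometric shell law sums to `C·X·(1 − X)⁻¹`**: if `f : ℕ → ℂ` vanishes at the indices `i` with `j₀ + i` even and equals `C·X^{κ+1}` at `j₀ + i = 2κ + 1`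
(`j₀ ≤ 1`, `‖X‖ < 1`), then `HasSum f (C·X·(1 − X)⁻¹)` (push-forward of Mathlib `hasSum_geometric_of_norm_lt_one` along the injective `κ ↦ 2κ + 1 − j₀`,
`Function.Injective.hasSum_iff`). [cite: Casselman1995, §6.4 p. 63] -/
theorem hasSum_of_even_zero_odd_geometric (f : ℕ → ℂ) (j₀ : ℕ) (hj₀ : j₀ ≤ 1) (C X : ℂ) (hX : ‖X‖ < 1)
    (heven : ∀ i : ℕ, Even (j₀ + i) → f i = 0) (hodd : ∀ i κ : ℕ, j₀ + i = 2 * κ + 1 → f i = C * X ^ (κ + 1)) :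
    HasSum f (C * X * (1 - X)⁻¹) := by
  have hgeo : HasSum (fun κ : ℕ => C * X ^ (κ + 1)) (C * X * (1 - X)⁻¹) := by
    have h := (hasSum_geometric_of_norm_lt_one hX).mul_left (C * X)
    refine h.congr_fun fun κ => ?_
    rw [pow_succ]; ring
  rcases Nat.le_one_iff_eq_zero_or_eq_one.1 hj₀ with rfl | rfl
  · -- `j₀ = 0`: the odd indices are `i = 2κ + 1`
    have hinj : Function.Injective (fun κ : ℕ => 2 * κ + 1) := fun a b h => by simpa using h
    have hoff : ∀ i ∉ Set.range (fun κ : ℕ => 2 * κ + 1), f i = 0 := by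
      intro i hi
      refine heven i ?_
      rcases Nat.even_or_odd i with he | ⟨κ, hκ⟩
      · simpa using he
      · exact absurd ⟨κ, hκ.symm⟩ hi
    refine (hinj.hasSum_iff hoff).1 ?_
    refine hgeo.congr_fun fun κ => ?_
    show f (2 * κ + 1) = _
    exact hodd (2 * κ + 1) κ (by ring)
  · -- `j₀ = 1`: the odd shells `1 + i = 2κ + 1` are the indices `i = 2κ`
    have hinj : Function.Injective (fun κ : ℕ => 2 * κ) := fun a b h => by simpa using h
    have hoff : ∀ i ∉ Set.range (fun κ : ℕ => 2 * κ), f i = 0 := by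
      intro i hi
      refine heven i ?_
      rcases Nat.even_or_odd i with ⟨κ, hκ⟩ | ho
      · exact absurd ⟨κ, by rw [hκ]; ring⟩ hi
      · obtain ⟨κ, hκ⟩ := ho
        exact ⟨κ + 1, by rw [hκ]; ring⟩
    refine (hinj.hasSum_iff hoff).1 ?_
    refine hgeo.congr_fun fun κ => ?_
    show f (2 * κ) = _
    exact hodd (2 * κ) κ (by ring)

/-- **THE RAMIFIED MASTER INTEGRAL, HYPOTHESIS-FIRST ON THE SHELL VALUES.**  For ANY measure `μ` on `N(L⁺_v)`, ANY `F : N → ℂ` integrable on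
`C(ν, j₀) = {e^{j₀} ≤ |z|_w ∧ |x|_w ≤ |ϖ|_w^ν·|z|_w}` with `j₀ ≤ 1`, Borel cut shells (`hmeas`), `‖X‖ < 1`: if every EVEN cut shell `{|z|_w = e^{j} ∧ |x|_w ≤ e^{j−ν}}` (`j` even, `j ≥ j₀`)
integrates to `0` (`heven`) and every ODD one `j = 2κ + 1` to `C·X^{κ+1}` (`hodd`), then `∫_{C(ν, j₀)} F dμ = C·X·(1 − X)⁻¹` — in particular `G₁ = G(1) = G(0) = G₂` (P-ram-1 §2: only the odd
shells survive, and the two thresholds differ by the empty∕vanishing shell `j = 0`).  §1 + `hasSum_of_even_zero_odd_geometric`. [cite: Keys1984, §7 Theorem (2) (d) p. 126]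
[cite: Casselman1980, §3] [cite: Casselman1995, §6.4 p. 63] [cite: Rogawski1990, §12.2 (2) p. 173] -/
theorem setIntegral_cutoff_eq_of_even_odd_shells [MeasurableSpace ↥(cmBorelTriple L 3 v).N] (μ : Measure ↥(cmBorelTriple L 3 v).N)
    {ϖ : w.1.adicCompletion L} (hϖ : Valued.v ϖ = WithZero.exp (-1 : ℤ))
    (hmeas : ∀ j t : ℤ, MeasurableSet {m : ↥(cmBorelTriple L 3 v).N |
      Valued.v (((((m : ↥(unitaryGroupOfForm (conjLocal L (IsCMField.complexConj L) v) (cmLocalForm L 3 v))) : GL (Fin 3) (LocalRing L v)) : Matrix (Fin 3) (Fin 3) (LocalRing L v)) 0 2) w) = WithZero.exp j ∧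
      Valued.v (((((m : ↥(unitaryGroupOfForm (conjLocal L (IsCMField.complexConj L) v) (cmLocalForm L 3 v))) : GL (Fin 3) (LocalRing L v)) : Matrix (Fin 3) (Fin 3) (LocalRing L v)) 0 1) w) ≤ WithZero.exp t})
    (F : ↥(cmBorelTriple L 3 v).N → ℂ) (ν j₀ : ℕ) (hj₀ : j₀ ≤ 1)
    (hF : IntegrableOn F {n : ↥(cmBorelTriple L 3 v).N |
      WithZero.exp (j₀ : ℤ) ≤ Valued.v (((((n : ↥(unitaryGroupOfForm (conjLocal L (IsCMField.complexConj L) v) (cmLocalForm L 3 v))) : GL (Fin 3) (LocalRing L v)) : Matrix (Fin 3) (Fin 3) (LocalRing L v)) 0 2) w) ∧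
      Valued.v (((((n : ↥(unitaryGroupOfForm (conjLocal L (IsCMField.complexConj L) v) (cmLocalForm L 3 v))) : GL (Fin 3) (LocalRing L v)) : Matrix (Fin 3) (Fin 3) (LocalRing L v)) 0 1) w) ≤
        Valued.v ϖ ^ ν * Valued.v (((((n : ↥(unitaryGroupOfForm (conjLocal L (IsCMField.complexConj L) v) (cmLocalForm L 3 v))) : GL (Fin 3) (LocalRing L v)) : Matrix (Fin 3) (Fin 3) (LocalRing L v)) 0 2) w)} μ)
    (C X : ℂ) (hX : ‖X‖ < 1)
    (heven : ∀ j : ℕ, j₀ ≤ j → Even j → ∫ n in {m : ↥(cmBorelTriple L 3 v).N |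
        Valued.v (((((m : ↥(unitaryGroupOfForm (conjLocal L (IsCMField.complexConj L) v) (cmLocalForm L 3 v))) : GL (Fin 3) (LocalRing L v)) : Matrix (Fin 3) (Fin 3) (LocalRing L v)) 0 2) w) = WithZero.exp (j : ℤ) ∧
        Valued.v (((((m : ↥(unitaryGroupOfForm (conjLocal L (IsCMField.complexConj L) v) (cmLocalForm L 3 v))) : GL (Fin 3) (LocalRing L v)) : Matrix (Fin 3) (Fin 3) (LocalRing L v)) 0 1) w) ≤ WithZero.exp ((j : ℤ) - ν)}, F n ∂μ = 0)
    (hodd : ∀ j κ : ℕ, j = 2 * κ + 1 → ∫ n in {m : ↥(cmBorelTriple L 3 v).N |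
        Valued.v (((((m : ↥(unitaryGroupOfForm (conjLocal L (IsCMField.complexConj L) v) (cmLocalForm L 3 v))) : GL (Fin 3) (LocalRing L v)) : Matrix (Fin 3) (Fin 3) (LocalRing L v)) 0 2) w) = WithZero.exp (j : ℤ) ∧
        Valued.v (((((m : ↥(unitaryGroupOfForm (conjLocal L (IsCMField.complexConj L) v) (cmLocalForm L 3 v))) : GL (Fin 3) (LocalRing L v)) : Matrix (Fin 3) (Fin 3) (LocalRing L v)) 0 1) w) ≤ WithZero.exp ((j : ℤ) - ν)}, F n ∂μ = C * X ^ (κ + 1)) :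
    ∫ n in {n : ↥(cmBorelTriple L 3 v).N |
      WithZero.exp (j₀ : ℤ) ≤ Valued.v (((((n : ↥(unitaryGroupOfForm (conjLocal L (IsCMField.complexConj L) v) (cmLocalForm L 3 v))) : GL (Fin 3) (LocalRing L v)) : Matrix (Fin 3) (Fin 3) (LocalRing L v)) 0 2) w) ∧
      Valued.v (((((n : ↥(unitaryGroupOfForm (conjLocal L (IsCMField.complexConj L) v) (cmLocalForm L 3 v))) : GL (Fin 3) (LocalRing L v)) : Matrix (Fin 3) (Fin 3) (LocalRing L v)) 0 1) w) ≤
        Valued.v ϖ ^ ν * Valued.v (((((n : ↥(unitaryGroupOfForm (conjLocal L (IsCMField.complexConj L) v) (cmLocalForm L 3 v))) : GL (Fin 3) (LocalRing L v)) : Matrix (Fin 3) (Fin 3) (LocalRing L v)) 0 2) w)}, F n ∂μ =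
      C * X * (1 - X)⁻¹ := by
  refine setIntegral_cutoff_eq_of_hasSum_shell_values L v w μ hϖ hmeas F ν j₀ hF _ _
    (hasSum_of_even_zero_odd_geometric _ j₀ hj₀ C X hX (fun i hi => heven (j₀ + i) (Nat.le_add_right _ _) hi) (fun i κ hκ => hodd (j₀ + i) κ hκ)) (fun i => rfl)

/-! ## §3 The constant relation in ★ (7)'s `Γ`-currency -/

/-- **`Γ²·X = (q−1)²·(q^{2ν+1})⁻¹` from the evaluation of `C²`**: if `C = V·Γ` with `V ≠ 0` (a Haar unit volume) and `C²·X = V²·((q−1)²·(q^{2ν+1})⁻¹)` (P-ram-1 §2 «`C² = q^{1−n}(1−q⁻¹)²∕X`»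
in the normalised volume `V`), then ★ (7) `R90S1BposRamDeterminantClosedForm`'s letter `hΓ` holds. [cite: Keys1984, §7 Theorem (2) (d) p. 126] [cite: Rogawski1990, §12.2 (2) p. 173] -/
theorem gamma_sq_mul_eq_of_const_sq (q C X Γ V : ℂ) (ν : ℕ) (hV : V ≠ 0) (hC : C = V * Γ)
    (hC2 : C ^ 2 * X = V ^ 2 * ((q - 1) ^ 2 * (q ^ (2 * ν + 1))⁻¹)) :
    Γ ^ 2 * X = (q - 1) ^ 2 * (q ^ (2 * ν + 1))⁻¹ := by
  rw [hC] at hC2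
  have hV2 : V ^ 2 ≠ 0 := pow_ne_zero 2 hV
  have h : V ^ 2 * (Γ ^ 2 * X) = V ^ 2 * ((q - 1) ^ 2 * (q ^ (2 * ν + 1))⁻¹) := by rw [← hC2]; ring
  exact mul_left_cancel₀ hV2 h

end Summit.HodgeConjecture.HodgeConjecture.R90.S1.BposRamMasterIntegral

end
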